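import Summits.Ventures.PercRepro.Night2BasisBlocking

/-!
# night-2: the lossy bases inside a target of the fat case contain exactly one of the two off-points

The fat split (`exists_fat_split`) applies to EVERY lossy basis pair, so every lossy five-point subset `Q′` of
`V` contains exactly one of the two points `w₀, x` off the fat closure (`lossyBasis_fat_split`).  Hence a target
`T` has at most `2 · C(|T ∖ K| − 2, 4)` lossy five-point subsets (`card_lossy_le_two_mul_choose`: `{w₀} ∪ F` or
`{x} ∪ F` with `F` a four-subset of `(T ∖ K) ∖ {w₀, x}`), and the basis pairs' mass at `T` is at most
`(221/360) · 2 · C(|T ∖ K| − 2, 4) / D` (`pi2MassH_le_fat_count`).  At the targets above `Q ∪ {x}` this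
structured count is SHARPER than the crude face count (paper `proofs/NIGHT-2-g32.md` §3.4: level-by-level it
gives `0.5 + 0.0995 (N−1) + 0.0332 C(N−1, 2) + 0.0142 C(N−1, 3) + …` for the blocking sum before the loaded
targets are removed).  `basis_pair_fair_of_fat_count_sum` is the corresponding form of the fair share.
-/

namespace PercRepro.Shadow

open PercRepro.ThmH PercRepro.PerFlat

variable {α : Type*} [DecidableEq α] {M : Matroid α} [M.Finite] {G : Finset α}

/-- **A lossy five-point subset of `V` contains exactly one of the two points off a fat closure.** -/
theorem lossyBasis_fat_split (hG : G ∈ flatsQ M (5 + 1)) (hd : (gr M \ G).card = 2) (hk : kColoops M G = 1)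
    {B₀ : Finset α} (hB₀ : B₀ ∈ thinMembers M 5 G) {w₀ x : α} (hD : G \ clF M B₀ = {w₀, x}) (hne : w₀ ≠ x)
    {Q' : Finset α} (hQ' : lossyBasis M G Q') :
    (w₀ ∈ Q' ∧ x ∉ Q') ∨ (x ∈ Q' ∧ w₀ ∉ Q') := by
  obtain ⟨w, hwQ', hok, hloss⟩ := hQ'
  obtain ⟨hthin, hwcl⟩ := hok
  have hm₀ : (G \ clF M B₀).card = 2 := by rw [hD, Finset.card_pair hne]
  have hwQ : w ∈ coloops M G ∪ Q' := Finset.mem_union_right _ hwQ'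
  have hins : insert w ((coloops M G ∪ Q').erase w) = coloops M G ∪ Q' := Finset.insert_erase hwQ
  obtain ⟨a, b, hab, hne', ha, hb⟩ := exists_fat_split hG hd hk hB₀ hm₀ hthin hwcl hloss
  rw [hins] at ha hb
  -- `{a, b} = {w₀, x}`
  have hab' : ({a, b} : Finset α) = {w₀, x} := by rw [← hab, hD]
  have haD : a ∈ ({w₀, x} : Finset α) := by rw [← hab']; exact Finset.mem_insert_self _ _
  have hbD : b ∈ ({w₀, x} : Finset α) := by
    rw [← hab']
    exact Finset.mem_insert_of_mem (Finset.mem_singleton_self _)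
  have hKcl : coloops M G ⊆ clF M B₀ :=
    (coloops_subset_of_mem_thinMembers hG (by omega) hB₀).trans
      (subset_clF_of_subset_gr ((subset_G_of_mem_thinMembers hB₀).trans (mem_flatsQ.1 hG).1))
  have hw₀K : w₀ ∉ coloops M G := fun h => by
    have : w₀ ∈ G \ clF M B₀ := by rw [hD]; exact Finset.mem_insert_self _ _
    exact (Finset.mem_sdiff.1 this).2 (hKcl h)
  have hxK : x ∉ coloops M G := fun h => by
    have : x ∈ G \ clF M B₀ := by
      rw [hD]
      exact Finset.mem_insert_of_mem (Finset.mem_singleton_self _)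
    exact (Finset.mem_sdiff.1 this).2 (hKcl h)
  rw [Finset.mem_insert, Finset.mem_singleton] at haD hbD
  rcases haD with rfl | rfl
  · -- a = w₀, so b = x
    have hbx : b = x := by
      rcases hbD with h | h
      · exact absurd h hne'.symm
      · exact h
    subst hbx
    rw [Finset.mem_union] at ha hb
    left
    refine ⟨?_, fun h => hb (Or.inr h)⟩
    rcases ha with h | h
    · exact absurd h hw₀K
    · exact h
  · -- a = x, so b = w₀
    have hbw : b = w₀ := by
      rcases hbD with h | h
      · exact h
      · exact absurd h hne'.symm
    subst hbw
    rw [Finset.mem_union] at ha hb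
    right
    refine ⟨?_, fun h => hb (Or.inr h)⟩
    rcases ha with h | h
    · exact absurd h hxK
    · exact h

/-- **At most `2 · C(|T ∖ K| − 2, 4)` lossy five-point subsets inside a target**: each is `{w₀} ∪ F` or `{x} ∪ F`
with `F` a four-subset of `(T ∖ K) ∖ {w₀, x}`. -/
theorem card_lossy_le_two_mul_choose (hG : G ∈ flatsQ M (5 + 1)) (hd : (gr M \ G).card = 2)
    (hk : kColoops M G = 1) {B₀ : Finset α} (hB₀ : B₀ ∈ thinMembers M 5 G) {w₀ x : α}
    (hD : G \ clF M B₀ = {w₀, x}) (hne : w₀ ≠ x) {T : Finset α} (hw₀ : w₀ ∈ T) (hx : x ∈ T) :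
    (((T \ coloops M G).powersetCard 5).filter (fun Q' => lossyBasis M G Q')).card ≤
      2 * ((T \ coloops M G).card - 2).choose 4 := by
  set P := (T \ coloops M G) \ {w₀, x} with hP
  have hw₀K : w₀ ∉ coloops M G := by
    intro h
    have hKcl : coloops M G ⊆ clF M B₀ :=
      (coloops_subset_of_mem_thinMembers hG (by omega) hB₀).trans
        (subset_clF_of_subset_gr ((subset_G_of_mem_thinMembers hB₀).trans (mem_flatsQ.1 hG).1))
    have : w₀ ∈ G \ clF M B₀ := by rw [hD]; exact Finset.mem_insert_self _ _
    exact (Finset.mem_sdiff.1 this).2 (hKcl h)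
  have hxK : x ∉ coloops M G := by
    intro h
    have hKcl : coloops M G ⊆ clF M B₀ :=
      (coloops_subset_of_mem_thinMembers hG (by omega) hB₀).trans
        (subset_clF_of_subset_gr ((subset_G_of_mem_thinMembers hB₀).trans (mem_flatsQ.1 hG).1))
    have : x ∈ G \ clF M B₀ := by
      rw [hD]
      exact Finset.mem_insert_of_mem (Finset.mem_singleton_self _)
    exact (Finset.mem_sdiff.1 this).2 (hKcl h)
  have hPcard : P.card = (T \ coloops M G).card - 2 := by
    rw [hP, Finset.card_sdiff_of_subset, Finset.card_pair hne]
    intro e he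
    rw [Finset.mem_insert, Finset.mem_singleton] at he
    rw [Finset.mem_sdiff]
    rcases he with rfl | rfl
    · exact ⟨hw₀, hw₀K⟩
    · exact ⟨hx, hxK⟩
  rw [← hPcard]
  -- the lossy sets lie in the union of the two images
  have hsub : ((T \ coloops M G).powersetCard 5).filter (fun Q' => lossyBasis M G Q') ⊆
      (P.powersetCard 4).image (fun F => insert w₀ F) ∪ (P.powersetCard 4).image (fun F => insert x F) := by
    intro Q' hQ'
    rw [Finset.mem_filter, Finset.mem_powersetCard] at hQ'
    obtain ⟨⟨hQ'T, hQ'5⟩, hlossy⟩ := hQ'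
    rw [Finset.mem_union, Finset.mem_image, Finset.mem_image]
    rcases lossyBasis_fat_split hG hd hk hB₀ hD hne hlossy with ⟨hw₀Q, hxQ⟩ | ⟨hxQ, hw₀Q⟩
    · left
      refine ⟨Q'.erase w₀, ?_, Finset.insert_erase hw₀Q⟩
      rw [Finset.mem_powersetCard, Finset.card_erase_of_mem hw₀Q, hQ'5]
      refine ⟨?_, rfl⟩
      intro e he
      rw [Finset.mem_erase] at he
      rw [hP, Finset.mem_sdiff, Finset.mem_insert, Finset.mem_singleton]
      exact ⟨hQ'T he.2, fun h => h.elim he.1 (fun h' => hxQ (h' ▸ he.2))⟩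
    · right
      refine ⟨Q'.erase x, ?_, Finset.insert_erase hxQ⟩
      rw [Finset.mem_powersetCard, Finset.card_erase_of_mem hxQ, hQ'5]
      refine ⟨?_, rfl⟩
      intro e he
      rw [Finset.mem_erase] at he
      rw [hP, Finset.mem_sdiff, Finset.mem_insert, Finset.mem_singleton]
      exact ⟨hQ'T he.2, fun h => h.elim (fun h' => hw₀Q (h' ▸ he.2)) he.1⟩
  calc (((T \ coloops M G).powersetCard 5).filter (fun Q' => lossyBasis M G Q')).card
      ≤ ((P.powersetCard 4).image (fun F => insert w₀ F) ∪ (P.powersetCard 4).image (fun F => insert x F)).card :=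
        Finset.card_le_card hsub
    _ ≤ ((P.powersetCard 4).image (fun F => insert w₀ F)).card +
        ((P.powersetCard 4).image (fun F => insert x F)).card := Finset.card_union_le _ _
    _ ≤ (P.powersetCard 4).card + (P.powersetCard 4).card :=
        Nat.add_le_add Finset.card_image_le Finset.card_image_le
    _ = 2 * P.card.choose 4 := by rw [Finset.card_powersetCard]; ring

/-- **The fat-case mass bound**: `pi2MassH T ≤ (221/360) · 2 · C(|T ∖ K| − 2, 4) / D` at every target containing
both off-points. -/
theorem pi2MassH_le_fat_count (hG : G ∈ flatsQ M (5 + 1)) (hd : (gr M \ G).card = 2) (hk : kColoops M G = 1)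
    (hfat : (fatClosures M 5 G 2).card ≤ 1) {B₀ : Finset α} (hB₀ : B₀ ∈ thinMembers M 5 G) {w₀ x : α}
    (hD : G \ clF M B₀ = {w₀, x}) (hne : w₀ ≠ x) {T : Finset α} (hTG : T ⊆ G) (hw₀ : w₀ ∈ T) (hx : x ∈ T) :
    pi2MassH M 5 G (bigP M G) T ≤
      ((2 * ((T \ coloops M G).card - 2).choose 4 : ℕ) : ℚ) * ((221 / 360) / ((2 ^ (G.card - 6) - 1 : ℕ) : ℚ)) := by
  refine le_trans (pi2MassH_le_lossy_count hG hd hk hfat hTG) ?_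
  apply mul_le_mul_of_nonneg_right _ (by positivity)
  exact_mod_cast card_lossy_le_two_mul_choose hG hd hk hB₀ hD hne hw₀ hx

/-- **The fat case of (FAIR) from the structured count**: with the fat split `G ∖ clF B₀ = {w₀, x}` of the lossy
basis pair, `1 ≤ Σ_{T ∈ tgtSets B z, x ∈ T, dload T = 0} capS T / ((221/360) · 2 · C(|T ∖ K| − 2, 4))` gives the
pair's fair share. -/
theorem basis_pair_fair_of_fat_count_sum (hG : G ∈ flatsQ M (5 + 1)) (hd : (gr M \ G).card = 2)
    (hk : kColoops M G = 1) (hs : ∀ e ∈ gr M, ∀ f ∈ gr M, e ≠ f → rkN M {e, f} = 2)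
    (hl : ∀ e ∈ gr M, M.Indep {e}) (hfat : (fatClosures M 5 G 2).card ≤ 1)
    {B₀ : Finset α} (hB₀ : B₀ ∈ thinMembers M 5 G) {w₀ x : α} (hD : G \ clF M B₀ = {w₀, x}) (hne : w₀ ≠ x)
    {B : Finset α} (hB : B ∈ thinMembers M 5 G) (hnP : ¬ bigP M G B) {z : α} (hz : z ∈ G \ clF M B)
    (hl0 : loss M 5 G B z ≠ 0) (hw₀ : w₀ ∈ insert z B) (hx : x ∉ insert z B)
    (hsum : 1 ≤ ∑ T ∈ (tgtSets M 5 G B z).filter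
      (fun T => x ∈ T ∧ dload M 5 G (bigP M G) (dshGT2 M 5 G) T = 0),
      capS M 5 G T / ((221 / 360 : ℚ) * ((2 * ((T \ coloops M G).card - 2).choose 4 : ℕ) : ℚ))) :
    loss M 5 G B z ≤ rhoL M 5 G B z * lossIncomeH M 5 G (bigP M G) (dshGT2 M 5 G) B z := by
  have hd' : (gr M \ G).card ≤ 5 := by omega
  have hB4 := card_sdiff_eq_four_of_not_bigP hG hd hk hB hnP
  have hblock := blocking_of_fat_split hG hd hk hB₀ hD hB hz hw₀ hx
  set 𝒯 := (tgtSets M 5 G B z).filter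
    (fun T => x ∈ T ∧ dload M 5 G (bigP M G) (dshGT2 M 5 G) T = 0) with h𝒯
  have h𝒯sub : 𝒯 ⊆ tgtSets M 5 G B z := Finset.filter_subset _ _
  set D : ℚ := ((2 ^ (G.card - 6) - 1 : ℕ) : ℚ) with hDdef
  have hDpos : 0 < D := by
    rw [hDdef]
    have h7 : 7 ≤ G.card := by
      have hKB : coloops M G ⊆ B := coloops_subset_of_mem_thinMembers hG hd' hB
      have hBG : B ⊆ G := subset_G_of_mem_thinMembers hB
      have h1 := Finset.card_sdiff_add_card_eq_card hKB
      rw [← kColoops_eq_card_coloops, hk] at h1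
      have h2 := two_le_card_sdiff_of_not_lay0 hG hd' (mem_thinMembers.1 hB).1 (mem_thinMembers.1 hB).2
      have hdisj : Disjoint B (G \ clF M B) := by
        rw [Finset.disjoint_left]
        intro a ha ha'
        exact (Finset.mem_sdiff.1 ha').2 (subset_clF_of_subset_gr (hBG.trans (mem_flatsQ.1 hG).1) ha)
      have h3 := Finset.card_le_card (Finset.union_subset hBG (Finset.sdiff_subset : G \ clF M B ⊆ G))
      rw [Finset.card_union_of_disjoint hdisj] at h3
      omega
    have : 2 ≤ 2 ^ (G.card - 6) := by
      calc 2 = 2 ^ 1 := by norm_num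
        _ ≤ 2 ^ (G.card - 6) := Nat.pow_le_pow_right (by norm_num) (by omega)
    exact_mod_cast (by omega : 0 < 2 ^ (G.card - 6) - 1)
  have hrho : rhoL M 5 G B z = loss M 5 G B z / D := by
    unfold rhoL
    rw [card_tgtSets hG (mem_thinMembers.1 hB).1 hz,
      card_sdiff_insert_eq_dqm1 (ρ := 5) hG hd' hB (by omega) hz, hk]
    have hcard : G.card - 1 - 5 = G.card - 6 := by omega
    rw [hcard]
  set c : Finset α → ℚ := fun T => (221 / 360 : ℚ) * ((2 * ((T \ coloops M G).card - 2).choose 4 : ℕ) : ℚ) with hc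
  set u : Finset α → ℚ := fun T => c T / D with hu
  have hmass : ∀ T ∈ 𝒯, pi2MassH M 5 G (bigP M G) T ≤ u T := by
    intro T hT
    rw [h𝒯, Finset.mem_filter] at hT
    have hTG : T ⊆ G := subset_G_of_mem_shadowAt (mem_tgtSets.1 hT.1).1
    have hw₀T : w₀ ∈ T := (mem_tgtSets.1 hT.1).2.1 hw₀
    have := pi2MassH_le_fat_count hG hd hk hfat hB₀ hD hne hTG hw₀T hT.2.1
    simp only [hu, hc]
    calc pi2MassH M 5 G (bigP M G) T
        ≤ ((2 * ((T \ coloops M G).card - 2).choose 4 : ℕ) : ℚ) *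
          ((221 / 360) / ((2 ^ (G.card - 6) - 1 : ℕ) : ℚ)) := this
      _ = (221 / 360 : ℚ) * ((2 * ((T \ coloops M G).card - 2).choose 4 : ℕ) : ℚ) / D := by
          rw [hDdef]
          ring
  have hv : ∀ T ∈ 𝒯, capS M 5 G T ≤ cap3 M 5 G (bigP M G) (dshGT2 M 5 G) T := by
    intro T hT
    rw [h𝒯, Finset.mem_filter] at hT
    have hTG : T ⊆ G := subset_G_of_mem_shadowAt (mem_tgtSets.1 hT.1).1
    have hKT : coloops M G ⊆ T := coloops_subset_of_mem_shadowAt (mem_tgtSets.1 hT.1).1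
    refine le_trans (capS_le_vCap_of_blocking hG hd hB hz hblock hT.1
      (Finset.singleton_subset_iff.2 hT.2.1) hT.2.2) (vCap_le_cap3 hG hd hk hs hl hfat hTG hKT)
  have hinc := lossIncomeH_ge_of_subfamily hG hd' (column_side_gt2 hG hd hk hs hl hfat) hB hnP hz hl0
    h𝒯sub u (capS M 5 G) hmass hv (fun T _ => capS_nonneg' hG hd' T)
  have hsplit : ∑ T ∈ 𝒯, capS M 5 G T / u T = D * ∑ T ∈ 𝒯, capS M 5 G T / c T := by
    rw [Finset.mul_sum]
    apply Finset.sum_congr rfl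
    intro T _
    simp only [hu]
    by_cases hc0 : c T = 0
    · rw [hc0]
      simp
    · field_simp
  have hD' : D ≤ ∑ T ∈ 𝒯, capS M 5 G T / u T := by
    rw [hsplit]
    have := mul_le_mul_of_nonneg_left hsum hDpos.le
    linarith
  rw [hrho]
  have hloss0 : 0 ≤ loss M 5 G B z := loss_nonneg (le_trans (by norm_num)
    (capS_ge_eleven_eighteenths_two_one hd hk (Finset.insert_subset (Finset.mem_sdiff.1 hz).1
      (subset_G_of_mem_thinMembers hB))))
  calc loss M 5 G B z = loss M 5 G B z / D * D := by field_simp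
    _ ≤ loss M 5 G B z / D * lossIncomeH M 5 G (bigP M G) (dshGT2 M 5 G) B z := by
        apply mul_le_mul_of_nonneg_left (hD'.trans hinc)
        exact div_nonneg hloss0 hDpos.le

end PercRepro.Shadow
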